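import Mathlib
import Summits.Ventures.HodgeRepro2.T5BallCharacters
import Summits.Ventures.HodgeRepro2.T5LocalSelfDuality
import Summits.Ventures.HodgeRepro2.T6N5LocalInertCompletion

/-!
# T6N5LocalTateChars — Tier 6, M2 sub-step N5 (t6-p8's half): Tate's additive characters, the normalised absolute
value, `ω_s`, the Haar measures and the self-dual measures of `E_v = L_w` on Mathlib's completions

The Tate side of the local sign datum (`T6N5LocalInertOnCompletion.TateSide`, `T6N5LocalRamOnCompletion.TateSideRam`)
is a bundle of parameters. This file models every one of them EXCEPT the ε-factor and the Weil-side data, at any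
finite place `w` of `L`:
* `PsiC` := the continuous non-trivial additive characters of `L_w` (`Circle`-valued as in p4's rows); `twist ψ a`
  := `ψ(a·)` (Tate's `ψ_a`) for a unit `a`;
* `cond ψ` := the exact conductor `n(ψ)` (`ψ` trivial on `B(n) = {v x ≤ exp n} = 𝔭_E^{−n}`, not on `B(n + 1)` — p4's
  `T5LocalSelfDuality.exists_conductor`; unique, `cond_eq_of`), with the twisting rule `n(ψ(a·)) = n(ψ) − log v(a)`
  (`cond_twist`, from p4's `T5BallCharacters` ball lemmas);
* `nrm a` := `q_E^{log v(a)} = q_E^{−ord(a)}`, the normalised absolute value (`q_E` the residue cardinality; Mathlib's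
  `v(ϖ) = exp(−1)`), positive and multiplicative; `omega s` := `‖·‖^s` as a character of `L_w^×`;
* `Meas` := `ℝ` (the positive multiples of the reference Haar measure with `vol(O_E) = 1`), `r · dx := r dx`;
  `sd ψ` := `q_E^{−n(ψ)/2}`, the self-dual measure of `ψ`, with `dx_{ψ_a} = ‖a‖^{1/2} dx_ψ` (`sd_twist`) — the
  normalisation convention behind Tate's (3.2.3);
* `TateParams` := what stays parametric: Tate's `ε(χ, ψ, dx)`, `χ_W`, `ϵ_δ(W)`, the theta predicate, the line signs.
`T6N5LocalInertTateSide` assembles these into the inert Tate side and proves the datum conditions.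
README §8(d): uses an L-value-free non-vanishing device: NO.
-/

namespace Summit.Ventures.HodgeRepro2.T6.N5LocalTateChars

open Summit.Ventures.HodgeRepro2 IsDedekindDomain HeightOneSpectrum
  Summit.Ventures.HodgeRepro2.T6.N5LocalInertCompletion

-- `L` in `Type` (universe `0`): `TateSide.Psi : Type`.
variable {L : Type} [Field L] [NumberField L] (w : HeightOneSpectrum (NumberField.RingOfIntegers L))

noncomputable section

/-! ### Tate's additive characters of `E_v = L_w`: continuous, non-trivial -/

/-- The continuous non-trivial additive characters of `L_w` (Tate's `ψ`), `Circle`-valued as in p4's rows. -/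
def PsiC : Type := {ψ : AddChar (w.adicCompletion L) Circle // Continuous ψ ∧ ψ ≠ 1}

/-- `ψ(a·)` is continuous when `ψ` is. -/
theorem continuous_mulShift (ψ : AddChar (w.adicCompletion L) Circle) (hψ : Continuous ψ)
    (a : w.adicCompletion L) : Continuous (ψ.mulShift a) := by
  have h : ⇑(ψ.mulShift a) = fun x => ψ (a * x) := funext fun x => AddChar.mulShift_apply
  rw [h]
  exact hψ.comp (continuous_const.mul continuous_id)

/-- `ψ(a·)` is non-trivial for a unit `a` when `ψ` is. -/
theorem mulShift_ne_one (ψ : AddChar (w.adicCompletion L) Circle) (hψ : ψ ≠ 1)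
    (a : (w.adicCompletion L)ˣ) : ψ.mulShift (a : w.adicCompletion L) ≠ 1 := by
  intro h
  apply hψ
  refine AddChar.ext _ _ fun x => ?_
  have hx := congrArg (fun χ : AddChar (w.adicCompletion L) Circle =>
    χ (((a⁻¹ : (w.adicCompletion L)ˣ) : w.adicCompletion L) * x)) h
  simp only [AddChar.mulShift_apply, AddChar.one_apply] at hx
  rw [← mul_assoc, Units.mul_inv, one_mul] at hx
  rw [hx, AddChar.one_apply]

/-- `ψ_a = ψ(a·)` for a unit `a` of `L_w`. -/
def twist (ψ : PsiC w) (a : (w.adicCompletion L)ˣ) : PsiC w :=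
  ⟨ψ.1.mulShift (a : w.adicCompletion L), continuous_mulShift w ψ.1 ψ.2.1 a, mulShift_ne_one w ψ.1 ψ.2.2 a⟩

/-- The value of the twist. -/
theorem twist_apply (ψ : PsiC w) (a : (w.adicCompletion L)ˣ) (x : w.adicCompletion L) :
    (twist w ψ a).1 x = ψ.1 ((a : w.adicCompletion L) * x) :=
  AddChar.mulShift_apply

/-! ### The exact conductor `n(ψ)` -/

/-- The exact conductor `n(ψ)` of a continuous non-trivial character: `ψ` is trivial on `B(n) = {v x ≤ exp n}`
(`= 𝔭_E^{−n}`) and non-trivial on `B(n + 1)` (p4's `T5LocalSelfDuality.exists_conductor`; Tate's `n(ψ)`). -/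
def cond (ψ : PsiC w) : ℤ := Classical.choose (T5LocalSelfDuality.exists_conductor ψ.1 ψ.2.1 ψ.2.2)

/-- The defining property of `cond`. -/
theorem cond_spec (ψ : PsiC w) :
    (∀ x, Valued.v x ≤ WithZero.exp (cond w ψ) → ψ.1 x = 1) ∧
      ∃ y, Valued.v y ≤ WithZero.exp (cond w ψ + 1) ∧ ψ.1 y ≠ 1 :=
  Classical.choose_spec (T5LocalSelfDuality.exists_conductor ψ.1 ψ.2.1 ψ.2.2)

/-- Exact conductors are unique. -/
theorem cond_eq_of (ψ : PsiC w) {c : ℤ} (h1 : ∀ x, Valued.v x ≤ WithZero.exp c → ψ.1 x = 1)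
    (h2 : ∃ y, Valued.v y ≤ WithZero.exp (c + 1) ∧ ψ.1 y ≠ 1) : cond w ψ = c := by
  obtain ⟨hc1, y, hy, hyne⟩ := cond_spec w ψ
  obtain ⟨z, hz, hzne⟩ := h2
  by_contra hne
  rcases lt_or_gt_of_ne hne with hlt | hlt
  · exact hyne (h1 y (le_trans hy (WithZero.exp_le_exp.mpr (by omega))))
  · exact hzne (hc1 z (le_trans hz (WithZero.exp_le_exp.mpr (by omega))))

/-- The valuation of a unit as `exp` of its logarithm. -/
theorem val_eq_exp_log (a : (w.adicCompletion L)ˣ) :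
    Valued.v (a : w.adicCompletion L) = WithZero.exp ((Valued.v (a : w.adicCompletion L)).log) :=
  (WithZero.exp_log ((Valuation.ne_zero_iff _).mpr a.ne_zero)).symm

/-- The twisting rule for the exact conductor: `n(ψ(a·)) = n(ψ) − log v(a)` (Tate (3.2.6): the level of
`ψ(a·)` shifts by `ord(a)`; from p4's `T5BallCharacters` ball lemmas). -/
theorem cond_twist (ψ : PsiC w) (a : (w.adicCompletion L)ˣ) :
    cond w (twist w ψ a) = cond w ψ - (Valued.v (a : w.adicCompletion L)).log := by
  obtain ⟨hc1, hc2⟩ := cond_spec w ψ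
  obtain ⟨l, hl⟩ : ∃ l : ℤ, Valued.v (a : w.adicCompletion L) = WithZero.exp l := ⟨_, val_eq_exp_log w a⟩
  rw [hl, WithZero.log_exp]
  apply cond_eq_of
  · intro x hx
    rw [twist_apply]
    refine T5BallCharacters.forall_mulShift_eq_one_of_val_le ψ.1 hc1 ?_ x hx
    rw [hl]
    exact WithZero.exp_le_exp.mpr (by omega)
  · by_contra hcon
    simp only [not_exists, not_and, not_not] at hcon
    have hle := T5BallCharacters.val_le_of_forall_mulShift_eq_one ψ.1 hc2 (t := (a : w.adicCompletion L))
      (m := cond w ψ - l + 1) (fun x hx => by rw [← twist_apply]; exact hcon x hx)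
    rw [hl] at hle
    have := WithZero.exp_le_exp.mp hle
    omega

/-! ### The normalised absolute value, `ω_s`, the Haar measures and the self-dual measures -/

/-- `q_E`: the cardinality of the residue field of `O_{L_w}`. -/
def qE : ℕ := Nat.card (IsLocalRing.ResidueField (w.adicCompletionIntegers L))

/-- `q_E > 0`. -/
theorem qE_pos : 0 < qE w := Nat.card_pos

/-- `(q_E : ℝ) ≠ 0`. -/
theorem qE_ne_zero : (qE w : ℝ) ≠ 0 := by
  exact_mod_cast (qE_pos w).ne'

/-- The normalised absolute value `‖a‖ = q_E^{−ord(a)} = q_E^{log v(a)}` on `L_w^×` (Mathlib's `v(ϖ) = exp(−1)`). -/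
def nrm (a : (w.adicCompletion L)ˣ) : ℝ := (qE w : ℝ) ^ (Multiplicative.toAdd (valHom w a))

/-- `‖a‖ > 0`. -/
theorem nrm_pos (a : (w.adicCompletion L)ˣ) : 0 < nrm w a :=
  zpow_pos (by exact_mod_cast qE_pos w) _

/-- `‖ab‖ = ‖a‖ ‖b‖`. -/
theorem nrm_mul (a b : (w.adicCompletion L)ˣ) : nrm w (a * b) = nrm w a * nrm w b := by
  unfold nrm
  rw [map_mul, toAdd_mul, zpow_add₀ (qE_ne_zero w)]

/-- `‖1‖ = 1`. -/
theorem nrm_one : nrm w 1 = 1 := by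
  unfold nrm
  rw [map_one, toAdd_one, zpow_zero]

/-- `‖a‖ = q_E^{log v(a)}`. -/
theorem nrm_eq (a : (w.adicCompletion L)ˣ) :
    nrm w a = (qE w : ℝ) ^ ((Valued.v (a : w.adicCompletion L)).log) := by
  unfold nrm
  rw [toAdd_valHom]

/-- `‖a‖^s ≠ 0` in `ℂ`. -/
theorem nrm_cpow_ne_zero (s : ℂ) (a : (w.adicCompletion L)ˣ) : ((nrm w a : ℝ) : ℂ) ^ s ≠ 0 := by
  rw [Ne, Complex.cpow_eq_zero_iff, not_and_or]
  left
  exact_mod_cast (nrm_pos w a).ne'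

/-- The unramified characters `ω_s = ‖·‖^s` of `L_w^×`. -/
def omega (s : ℂ) : (w.adicCompletion L)ˣ →* ℂˣ where
  toFun a := Units.mk0 (((nrm w a : ℝ) : ℂ) ^ s) (nrm_cpow_ne_zero w s a)
  map_one' := by
    apply Units.ext
    simp only [Units.val_mk0, Units.val_one, nrm_one, Complex.ofReal_one, Complex.one_cpow]
  map_mul' a b := by
    apply Units.ext
    simp only [Units.val_mk0, Units.val_mul]
    rw [nrm_mul, Complex.ofReal_mul, Complex.mul_cpow_ofReal_nonneg (nrm_pos w a).le (nrm_pos w b).le]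

/-- The value of `ω_s`: `ω_s(a) = ‖a‖^s`. -/
theorem omega_apply (s : ℂ) (a : (w.adicCompletion L)ˣ) :
    ((omega w s a : ℂˣ) : ℂ) = ((nrm w a : ℝ) : ℂ) ^ s := rfl

/-- The self-dual Haar measure of `ψ`, as a multiple of the reference measure (`vol(O_E) = 1`):
`dx_ψ = q_E^{−n(ψ)/2}`. -/
def sd (ψ : PsiC w) : ℝ := Real.sqrt ((qE w : ℝ) ^ (-(cond w ψ)))

/-- `dx_{ψ_a} = ‖a‖^{1/2} dx_ψ` (the self-dual measure rule behind Tate's (3.2.3) normalisation). -/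
theorem sd_twist (ψ : PsiC w) (a : (w.adicCompletion L)ˣ) :
    sd w (twist w ψ a) = Real.sqrt (nrm w a) * sd w ψ := by
  unfold sd
  rw [cond_twist, nrm_eq, ← Real.sqrt_mul (zpow_pos (by exact_mod_cast qE_pos w) _).le,
    ← zpow_add₀ (qE_ne_zero w)]
  congr 2
  ring

/-! ### The Weil-side parameters and the ε-factor -/

/-- The parameters of the Tate side that have no Mathlib model: Tate's ε-factor, the Weil-side character `χ_W`,
the sign `ϵ_δ(W)`, the theta predicate and the line signs. -/
structure TateParams (E : Type) [CommGroup E] (Psi Meas : Type) where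
  /-- Tate's `ε(χ, ψ, dx)` -/
  epsT : (E →* ℂˣ) → Psi → Meas → ℂ
  /-- the Weil-side character -/
  χW : E →* ℂˣ
  /-- the Weil-side sign -/
  epsdW : ℤˣ
  /-- the (A1) predicate -/
  Theta : ℤˣ → (E →* ℂˣ) → Prop
  /-- the line signs -/
  ηLine : Fin 2 → ℤˣ
  /-- `η_v(u)` -/
  ηu : ℤˣ

end

end Summit.Ventures.HodgeRepro2.T6.N5LocalTateChars
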